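import Literature.Computability.Cryptography.VanDamSeroussiReplicatedFourier
import HarnessLib

/-!
# The repetition kernel puts half of its mass on nonzero frequencies (van Dam–Seroussi, analysis II)

Topic `Literature/Computability/Cryptography`; sequel of `VanDamSeroussiReplicatedFourier.lean` (the repetition
kernel `S(y) = dirichletSum N L p y` of the `L`-fold repeated embedding of `ℤ/p` data in a register of
order `N`, its decay `‖S(y)‖·|offset y| ≤ 1/2` and Parseval `Σ_{y<N} ‖S(y)‖² = LN`), towards the discharge
of `VanDamSeroussi2002_cubicGaussSumPhase_qsolvable`. The reference state of the Hadamard test of the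
sequel files has flat `ℤ/p`-spectrum, while the character state has no component at the frequency
`k ≡ 0 (mod p)`; the signal is therefore proportional to the kernel's mass OFF the two dyadic cells
`nearIdx y ∈ {0, p}`, which this file bounds from below (everything PROVED, [folklore]):

* `goodWeight N L p = Σ_{y<N, p ∤ nearIdx y} ‖S(y)‖²`, `goodWeight ≤ LN`;
* `sum_le_of_decay` — a counting lemma: values `≤ L²` and `≤ N²/(4p²y²)` sum to `≤ (3/2)NL/p` over
  positive integers when `N ≥ 8pL` (split at `⌊N/(2pL)⌋`, tail `Σ 1/y² ≤ 1/K`);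
* `sum_cell_zero_le`, `sum_cell_top_le` — the two bad cells carry at most `L² + (3/2)NL/p` and
  `(3/2)NL/p` (the decay bound, and the reflection `y ↦ N − y` for the top cell);
* **`half_le_goodWeight`**: `LN/2 ≤ goodWeight` for `p ≥ 7` and `N ≥ 8pL`.

## References

* W. van Dam, G. Seroussi, arXiv:quant-ph/0207131 (2002), §4 Algorithm 1, Thm. 1 [VanDamSeroussi2002].
* L. Hales, S. Hallgren, FOCS 2000 (Fourier sampling over `ℤ/p` by repetition) [HalesHallgren2000].
-/

noncomputable section

namespace Literature.Computability.Cryptography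

namespace VanDamSeroussi

open Finset Complex
open Literature.Computability.QuantumComplexity.QFTQubits

variable (N L p : ℕ)

/-! ### The weight off the frequencies `k ≡ 0 (mod p)` -/

/-- `goodWeight N L p = Σ_{y<N, p ∤ nearIdx y} ‖S(y)‖²`: the squared mass of the repetition kernel on the
dyadic cells whose nearest `ℤ/p`-frequency is nonzero modulo `p`. [folklore] -/
def goodWeight : ℝ :=
  ∑ y ∈ (range N).filter (fun y => ¬ p ∣ nearIdx N p y), ‖dirichletSum N L p y‖ ^ 2

variable {N L p} in
/-- `goodWeight ≤ L·N` (Parseval). [folklore] -/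
theorem goodWeight_le (hN : 0 < N) (hp : 0 < p) (hLN : L * p ≤ N) : goodWeight N L p ≤ L * N := by
  rw [goodWeight, ← sum_norm_sq_dirichletSum hN hp hLN]
  exact sum_le_sum_of_subset_of_nonneg (filter_subset _ _) fun _ _ _ => sq_nonneg _

variable {N p} in
/-- `nearIdx y ≤ p` for `y < N`. [folklore] -/
theorem nearIdx_le (hN : 0 < N) {y : ℕ} (hy : y < N) : nearIdx N p y ≤ p := by
  unfold nearIdx
  apply Nat.le_of_lt_succ
  rw [Nat.div_lt_iff_lt_mul (by omega)]
  have h1 : 2 * p * y ≤ 2 * p * N := Nat.mul_le_mul_left _ hy.le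
  have h2 : (p + 1) * (2 * N) = 2 * p * N + 2 * N := by ring
  rw [Nat.succ_eq_add_one, h2]
  omega

variable {N L p} in
/-- **Counting lemma**: if `0 ≤ F y ≤ L²` and `F y ≤ N²/(4p²y²)` on a finite set `T` of positive integers,
then `Σ_{y ∈ T} F y ≤ (3/2)·N·L/p` provided `N ≥ 8pL` (split at `K = ⌊N/(2pL)⌋`; the tail is `Σ 1/y²`).
[folklore] -/
theorem sum_le_of_decay (hp : 0 < p) (hL : 0 < L) (hN : 8 * p * L ≤ N) (T : Finset ℕ)
    (hT : ∀ y ∈ T, 1 ≤ y) (F : ℕ → ℝ) (hF1 : ∀ y ∈ T, F y ≤ (L : ℝ) ^ 2)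
    (hF2 : ∀ y ∈ T, F y ≤ (N : ℝ) ^ 2 / (4 * p ^ 2) * ((y : ℝ) ^ 2)⁻¹) :
    ∑ y ∈ T, F y ≤ 3 / 2 * N * L / p := by
  set K := N / (2 * p * L) with hK
  have hpL : 0 < 2 * p * L := by positivity
  have hK4 : 4 ≤ K := by
    rw [hK, Nat.le_div_iff_mul_le hpL]; linarith
  have hKle : K * (2 * p * L) ≤ N := Nat.div_mul_le_self _ _
  have hNlt : N < (K + 1) * (2 * p * L) := by
    have := Nat.lt_mul_div_succ N hpL; rw [← hK] at this; linarith
  have hpr : (0 : ℝ) < p := by exact_mod_cast hp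
  have hLr : (0 : ℝ) < L := by exact_mod_cast hL
  have hKr : (4 : ℝ) ≤ K := by exact_mod_cast hK4
  have hKle' : (K : ℝ) * (2 * p * L) ≤ N := by exact_mod_cast hKle
  have hNlt' : (N : ℝ) < (K + 1) * (2 * p * L) := by exact_mod_cast hNlt
  -- split `T` at `K`
  rw [← sum_filter_add_sum_filter_not T (fun y => y ≤ K)]
  have h1 : ∑ y ∈ T.filter (fun y => y ≤ K), F y ≤ (K : ℝ) * L ^ 2 := by
    calc ∑ y ∈ T.filter (fun y => y ≤ K), F y ≤ ∑ y ∈ T.filter (fun y => y ≤ K), (L : ℝ) ^ 2 :=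
          sum_le_sum fun y hy => hF1 y (mem_filter.1 hy).1
      _ = (T.filter (fun y => y ≤ K)).card * (L : ℝ) ^ 2 := by rw [sum_const, nsmul_eq_mul]
      _ ≤ K * (L : ℝ) ^ 2 := by
          gcongr
          have hsub : T.filter (fun y => y ≤ K) ⊆ Icc 1 K := fun y hy => by
            rw [mem_filter] at hy; rw [mem_Icc]; exact ⟨hT y hy.1, hy.2⟩
          have := card_le_card hsub
          rw [Nat.card_Icc] at this
          exact_mod_cast (by omega : (T.filter (fun y => y ≤ K)).card ≤ K)
  have h2 : ∑ y ∈ T.filter (fun y => ¬ y ≤ K), F y ≤ (N : ℝ) ^ 2 / (4 * p ^ 2) * (K : ℝ)⁻¹ := by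
    have hK0 : K ≠ 0 := by omega
    set M := max K (T.sup id) with hM
    have hsub : T.filter (fun y => ¬ y ≤ K) ⊆ Ioc K M := fun y hy => by
      rw [mem_filter] at hy; rw [mem_Ioc]
      exact ⟨by omega, le_max_of_le_right (le_sup (f := id) hy.1)⟩
    calc ∑ y ∈ T.filter (fun y => ¬ y ≤ K), F y
        ≤ ∑ y ∈ T.filter (fun y => ¬ y ≤ K), (N : ℝ) ^ 2 / (4 * p ^ 2) * ((y : ℝ) ^ 2)⁻¹ :=
          sum_le_sum fun y hy => hF2 y (mem_filter.1 hy).1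
      _ ≤ ∑ y ∈ Ioc K M, (N : ℝ) ^ 2 / (4 * p ^ 2) * ((y : ℝ) ^ 2)⁻¹ :=
          sum_le_sum_of_subset_of_nonneg hsub fun _ _ _ => by positivity
      _ = (N : ℝ) ^ 2 / (4 * p ^ 2) * ∑ y ∈ Ioc K M, ((y : ℝ) ^ 2)⁻¹ := by rw [mul_sum]
      _ ≤ (N : ℝ) ^ 2 / (4 * p ^ 2) * (K : ℝ)⁻¹ := by
          gcongr
          exact (sum_Ioc_inv_sq_le_sub (α := ℝ) hK0 (le_max_left K (T.sup id))).trans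
            (sub_le_self _ (by positivity))
  -- arithmetic: `K L² ≤ NL/(2p)` and `N²/(4p²K) ≤ NL/p`
  have hA : (K : ℝ) * L ^ 2 ≤ N * L / (2 * p) := by
    rw [le_div_iff₀ (by positivity)]; nlinarith
  have hB : (N : ℝ) ^ 2 / (4 * p ^ 2) * (K : ℝ)⁻¹ ≤ N * L / p := by
    have hK0 : (0 : ℝ) < K := by linarith
    rw [← div_eq_mul_inv, div_div, div_le_div_iff₀ (by positivity) hpr]
    -- `N ≤ 4 p L K` since `N < 2pL(K+1) ≤ 4pLK`
    have hN4 : (N : ℝ) ≤ 4 * p * L * K := by nlinarith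
    have hN0 : (0 : ℝ) ≤ N := Nat.cast_nonneg N
    calc (N : ℝ) ^ 2 * p = N * p * N := by ring
      _ ≤ N * p * (4 * p * L * K) := by gcongr
      _ = N * L * (4 * p ^ 2 * K) := by ring
  calc _ ≤ (K : ℝ) * L ^ 2 + (N : ℝ) ^ 2 / (4 * p ^ 2) * (K : ℝ)⁻¹ := add_le_add h1 h2
    _ ≤ N * L / (2 * p) + N * L / p := add_le_add hA hB
    _ = 3 / 2 * N * L / p := by field_simp; ring

variable {N L p} in
/-- From the kernel decay: `‖S(y)‖² ≤ N²/(4p²u²)` whenever `|offset y| = p·u/N` with `u ≥ 1`. [folklore] -/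
theorem norm_sq_dirichletSum_le_of_offset (hN : 0 < N) (hp : 0 < p) {y u : ℕ} (hu : 1 ≤ u)
    (hoff : |offset N p y| = (p : ℝ) * u / N) :
    ‖dirichletSum N L p y‖ ^ 2 ≤ (N : ℝ) ^ 2 / (4 * p ^ 2) * ((u : ℝ) ^ 2)⁻¹ := by
  have hNr : (0 : ℝ) < N := by exact_mod_cast hN
  have hpr : (0 : ℝ) < p := by exact_mod_cast hp
  have hur : (1 : ℝ) ≤ u := by exact_mod_cast hu
  have h := norm_dirichletSum_mul_abs_offset_le L p hN y
  rw [hoff] at h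
  have hS : ‖dirichletSum N L p y‖ ≤ N / (2 * p * u) := by
    rw [le_div_iff₀ (by positivity)]
    calc ‖dirichletSum N L p y‖ * (2 * p * u) = 2 * (‖dirichletSum N L p y‖ * (p * u / N)) * N := by
          field_simp
      _ ≤ 2 * (1 / 2) * N := by gcongr
      _ = N := by ring
  calc ‖dirichletSum N L p y‖ ^ 2 ≤ (N / (2 * p * u)) ^ 2 := pow_le_pow_left₀ (norm_nonneg _) hS 2
    _ = (N : ℝ) ^ 2 / (4 * p ^ 2) * ((u : ℝ) ^ 2)⁻¹ := by
        field_simp; ring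

variable {N L p} in
/-- The mass of the kernel on the cell `k_y = 0` is at most `L² + (3/2)NL/p`. [folklore] -/
theorem sum_cell_zero_le (hN : 0 < N) (hp : 0 < p) (hL : 0 < L) (h8 : 8 * p * L ≤ N) :
    ∑ y ∈ (range N).filter (fun y => nearIdx N p y = 0), ‖dirichletSum N L p y‖ ^ 2 ≤
      (L : ℝ) ^ 2 + 3 / 2 * N * L / p := by
  have h0mem : (0 : ℕ) ∈ (range N).filter (fun y => nearIdx N p y = 0) := by
    rw [mem_filter, mem_range]
    refine ⟨hN, ?_⟩
    unfold nearIdx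
    rw [mul_zero, zero_add]
    exact Nat.div_eq_of_lt (by omega)
  rw [← add_sum_erase _ _ h0mem]
  refine add_le_add (pow_le_pow_left₀ (norm_nonneg _) (norm_dirichletSum_le N L p 0) 2) ?_
  refine sum_le_of_decay hp hL h8 _ (fun y hy => ?_) _ (fun y _ => ?_) (fun y hy => ?_)
  · have := (mem_erase.1 hy).1; omega
  · exact pow_le_pow_left₀ (norm_nonneg _) (norm_dirichletSum_le N L p y) 2
  · obtain ⟨hy0, hy⟩ := mem_erase.1 hy
    have hk := (mem_filter.1 hy).2
    refine norm_sq_dirichletSum_le_of_offset hN hp (Nat.one_le_iff_ne_zero.2 hy0) ?_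
    have hoff : offset N p y = (p : ℝ) * y / N := by unfold offset; rw [hk]; simp
    rw [hoff, abs_of_nonneg (by positivity)]

variable {N L p} in
/-- The mass of the kernel on the cell `k_y = p` is at most `(3/2)NL/p` (reflect `y ↦ N − y`). [folklore] -/
theorem sum_cell_top_le (hN : 0 < N) (hp : 0 < p) (hL : 0 < L) (h8 : 8 * p * L ≤ N) :
    ∑ y ∈ (range N).filter (fun y => nearIdx N p y = p), ‖dirichletSum N L p y‖ ^ 2 ≤
      3 / 2 * N * L / p := by
  -- reindex by `u = N - y`
  have hre : ∑ y ∈ (range N).filter (fun y => nearIdx N p y = p), ‖dirichletSum N L p y‖ ^ 2 =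
      ∑ u ∈ ((range N).filter (fun y => nearIdx N p y = p)).image (fun y => N - y),
        ‖dirichletSum N L p (N - u)‖ ^ 2 := by
    rw [sum_image]
    · refine sum_congr rfl fun y hy => ?_
      rw [Nat.sub_sub_self (mem_range.1 (mem_filter.1 hy).1).le]
    · intro y hy y' hy' h
      have h1 := mem_range.1 (mem_filter.1 hy).1
      have h2 := mem_range.1 (mem_filter.1 hy').1
      change N - y = N - y' at h
      omega
  rw [hre]
  refine sum_le_of_decay hp hL h8 _ (fun u hu => ?_) _ (fun u _ => ?_) (fun u hu => ?_)
  · obtain ⟨y, hy, rfl⟩ := mem_image.1 hu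
    have := mem_range.1 (mem_filter.1 hy).1
    change 1 ≤ N - y
    omega
  · exact pow_le_pow_left₀ (norm_nonneg _) (norm_dirichletSum_le N L p _) 2
  · obtain ⟨y, hy, rfl⟩ := mem_image.1 hu
    obtain ⟨hyN, hk⟩ := mem_filter.1 hy
    have hyN := mem_range.1 hyN
    rw [Nat.sub_sub_self hyN.le]
    refine norm_sq_dirichletSum_le_of_offset hN hp (by omega : 1 ≤ N - y) ?_
    have hNr : (0 : ℝ) < N := by exact_mod_cast hN
    have hoff : offset N p y = -((p : ℝ) * (N - y : ℕ) / N) := by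
      unfold offset; rw [hk, Nat.cast_sub hyN.le]; field_simp; ring
    rw [hoff, abs_neg, abs_of_nonneg (by positivity)]

variable {N L p} in
/-- **At least half of the kernel's mass sits on nonzero frequencies**: `LN/2 ≤ goodWeight` for `p ≥ 7`
and `N ≥ 8pL`. [folklore] -/
theorem half_le_goodWeight (hp7 : 7 ≤ p) (hL : 0 < L) (h8 : 8 * p * L ≤ N) :
    (L : ℝ) * N / 2 ≤ goodWeight N L p := by
  have hp : 0 < p := by omega
  have hN : 0 < N := lt_of_lt_of_le (by positivity) h8
  have hLN : L * p ≤ N := by nlinarith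
  have hNr : (0 : ℝ) < N := by exact_mod_cast hN
  have hpr : (7 : ℝ) ≤ p := by exact_mod_cast hp7
  have hLr : (0 : ℝ) < L := by exact_mod_cast hL
  have h8r : (8 : ℝ) * p * L ≤ N := by exact_mod_cast h8
  -- total = bad + good
  set bad := ∑ y ∈ (range N).filter (fun y => p ∣ nearIdx N p y), ‖dirichletSum N L p y‖ ^ 2
    with hbad_def
  have htot : bad + goodWeight N L p = L * N := by
    rw [hbad_def, goodWeight, sum_filter_add_sum_filter_not]
    exact sum_norm_sq_dirichletSum hN hp hLN
  clear_value bad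
  -- bad ≤ cell 0 + cell p
  have hbad : bad ≤ ((L : ℝ) ^ 2 + 3 / 2 * N * L / p) + 3 / 2 * N * L / p := by
    have hsub : (range N).filter (fun y => p ∣ nearIdx N p y) ⊆
        (range N).filter (fun y => nearIdx N p y = 0) ∪ (range N).filter (fun y => nearIdx N p y = p) := by
      intro y hy
      rw [mem_filter] at hy
      rw [mem_union, mem_filter, mem_filter]
      have hle := nearIdx_le (p := p) hN (mem_range.1 hy.1)
      rcases hy.2 with ⟨c, hc⟩
      rcases Nat.eq_zero_or_pos c with rfl | hc0
      · exact Or.inl ⟨hy.1, by simpa using hc⟩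
      · right; refine ⟨hy.1, le_antisymm hle ?_⟩
        calc p = p * 1 := (mul_one p).symm
          _ ≤ p * c := Nat.mul_le_mul_left p hc0
          _ = _ := hc.symm
    have hdisj : Disjoint ((range N).filter (fun y => nearIdx N p y = 0))
        ((range N).filter (fun y => nearIdx N p y = p)) := by
      rw [disjoint_filter]; intro y _ h0 h1; omega
    rw [hbad_def]
    calc _ ≤ ∑ y ∈ (range N).filter (fun y => nearIdx N p y = 0) ∪
              (range N).filter (fun y => nearIdx N p y = p), ‖dirichletSum N L p y‖ ^ 2 :=
          sum_le_sum_of_subset_of_nonneg hsub fun _ _ _ => sq_nonneg _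
      _ = _ := sum_union hdisj
      _ ≤ _ := add_le_add (sum_cell_zero_le hN hp hL h8) (sum_cell_top_le hN hp hL h8)
  -- arithmetic: with `Q = NL/p ≤ NL/7` and `L² ≤ Q/8`, `bad ≤ (25/8) Q ≤ (25/56) NL ≤ NL/2`
  set Q : ℝ := N * L / p with hQ
  have hQle : Q ≤ N * L / 7 := div_le_div_of_nonneg_left (by positivity) (by norm_num) hpr
  have hL2 : (L : ℝ) ^ 2 ≤ Q / 8 := by
    rw [hQ, le_div_iff₀ (by norm_num), le_div_iff₀ (by positivity)]; nlinarith
  have h32 : (3 : ℝ) / 2 * N * L / p = 3 / 2 * Q := by rw [hQ]; ring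
  rw [h32] at hbad
  have hcomm : (L : ℝ) * N = N * L := mul_comm _ _
  rw [hcomm] at htot ⊢
  have hb : bad ≤ 25 / 56 * (N * L) := by linarith
  have hNL : (0 : ℝ) < N * L := by positivity
  linarith

end VanDamSeroussi

end Literature.Computability.Cryptography
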